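import Literature.AlgebraicGeometry.Frobenioids.BirationalizationProp44UnitsProofs
import Literature.AlgebraicGeometry.Frobenioids.BiratGerms
import Literature.AlgebraicGeometry.Frobenioids.Isotropification
import Literature.AlgebraicGeometry.Frobenioids.IsotropicFrobenioid
import Literature.AlgebraicGeometry.Frobenioids.IsotropicSubcategory
import Literature.AlgebraicGeometry.Frobenioids.IsometricPreSteps
import HarnessLib

/-!
# Frobenioids I, Proposition 4.4 (iii) at ISOTROPIC objects of an arbitrary Frobenioid

Mochizuki, *The geometry of Frobenioids I: the general theory*, Kyushu J. Math. **62** (2008)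
293–400, §4, Proposition 4.4 (iii) p. 83, with Proposition 2.2 p. 45 (the functor `O^×(−)` on `D` is
DEFINED through the isotropic objects `C^istr`) and Proposition 1.9 (iv)/(v) pp. 31–33
[cite: MochizukiFrdI2008, Prop. 4.4 (iii) p.83].

PROOF-ONLY file (theorems only). `BirationalizationProp44UnitsProofs.lean` proves Prop. 4.4 (iii) at
THE birationalization for Frobenioids of isotropic TYPE, and
`BirationalizationProp44iiiCounterexample.lean` shows it FAILS at a non-isotropic object (the
two-level Frobenioid). This file proves the sharp corrected form, valid for EVERY Frobenioid:
**the surjection `O^×(A^birat) ↠ Φ^birat(Base A)` (canonical `Φ^birat` of seat abc-iut-L1-t5) holds at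
every ISOTROPIC object `A`** (`prop44iii_at_isIsotropic`), the kernel clause holding everywhere. Route:
* `invDiv_hullMor`, `exists_biratGerm_hull` — a birational germ at `A′` is the pull-back along
  `Base(A′ → A′^istr)` of a germ at the isotropic hull `A′^istr` (apply abc-iut-L6-t19's
  isotropification `hullMor`, Prop. 1.9 (v): it preserves pre-steps, co-angularity, base-equivalence,
  and `Div(f^istr) = (Base hull)⁻¹* Div f`);
* `biratGerms_istr` — the germs of the Frobenioid `C^istr` (abc-iut-L1-t1's `istrFunctor F`,
  `isFrobenioid_istr`) at an isotropic `A` are the germs of `C` at `A` (sources of co-angular pre-steps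
  into isotropic objects are isotropic, Prop. 1.9 (iv));
* `biratSubfunctor_istr_carrier` — hence the canonical subfunctors `Φ^birat` of `C` and of `C^istr`
  COINCIDE (both generated by the pulled-back germs at isotropic objects);
* `coe_biratSubgroup_eq_biratGerms_of_isIsotropic` — so abc-iut-L1-t10's theorem for Frobenioids of
  isotropic type (`coe_biratSubfunctor_baseObj`, applied to `C^istr`) gives `Φ^birat(Base A) =` germs at
  `A` for every isotropic OBJECT `A` of an arbitrary Frobenioid; with `range_biratDivHom` /
  `biratDivHom_eq_one_iff` of `BirationalizationProp44UnitsProofs.lean` this is Prop. 4.4 (iii) at `A`.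
No statement of the paper is strengthened beyond what its proof via Prop. 2.2 gives; nothing here
bears on the disputed parts of [IUTchIII].
-/

namespace Literature.AlgebraicGeometry.Frobenioids

open CategoryTheory Opposite

namespace PreFrobenioid

universe w v v' u u'

variable {D : Type u} [Category.{v} D] {Φ : Dᵒᵖ ⥤ CommMonCat.{w}}
  {C : Type u'} [Category.{v'} C] {F : C ⥤ ElemFrobenioid Φ}

/-! ### Germs are pulled back from the isotropic hull -/

/-- `(Base f^istr)⁻¹* Div(f^istr) = (Base hull_{A′})⁻¹* ((Base f)⁻¹* Div f)` for a base-isomorphism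
`f : Y → A′` and its isotropification `f^istr : Y^istr → A′^istr` (Remark 1.1.1 / Prop. 1.9 (v)).
[cite: MochizukiFrdI2008, Prop. 1.9 (v) p.33] -/
theorem invDiv_hullMor (hF : IsFrobenioid F) {Y A' : C} (f : Y ⟶ A') (hf : IsBaseIso F f) :
    haveI : IsIso (Base F (hullHom hF A')) := (isIsotropicHull_hullHom hF A').2.1.2
    invDiv F (hullMor hF f) (isBaseIso_hullMor hF f hf) =
      pull Φ (inv (Base F (hullHom hF A'))) (invDiv F f hf) := by
  haveI : IsIso (Base F (hullHom hF A')) := (isIsotropicHull_hullHom hF A').2.1.2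
  haveI : IsIso (Base F (hullHom hF Y)) := (isIsotropicHull_hullHom hF Y).2.1.2
  haveI : IsIso (Base F f) := hf
  haveI : IsIso (Base F (hullMor hF f)) := isBaseIso_hullMor hF f hf
  apply pull_injective (Base F (hullMor hF f))
  rw [pull_invDiv, div_hullMor, ← pull_comp, base_hullMor, Category.assoc, Category.assoc,
    IsIso.hom_inv_id, Category.comp_id, pull_comp, pull_invDiv]

/-- **A germ at `A′` is a pulled-back germ at the isotropic hull**: for a pair `(δ₁, δ₂ : Y → A′)` of
base-equivalent pre-steps with `δ₁` co-angular, the isotropified pair `(δ₁^istr, δ₂^istr : Y^istr →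
A′^istr)` is again such a pair (every arrow between hulls is co-angular, Prop. 1.4 (i)) and
`Φ(δ₁)⁻¹Div δ₁ − Φ(δ₂)⁻¹Div δ₂ = Φ(hull_{A′})(germ of the isotropified pair)`.
[cite: MochizukiFrdI2008, Prop. 4.4 (iii) p.83] -/
theorem exists_biratGerm_hull (hF : IsFrobenioid F) {A' : C}
    {d : Algebra.GrothendieckGroup (Φ.obj (op (baseObj F A')))} (hd : d ∈ biratGerms F A') :
    ∃ d' ∈ biratGerms F (hullObj hF A'), d = pullGp Φ (Base F (hullHom hF A')) d' := by
  obtain ⟨Y, δ₁, δ₂, h₁, h₂, hb, rfl⟩ := hd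
  haveI : IsIso (Base F (hullHom hF A')) := (isIsotropicHull_hullHom hF A').2.1.2
  have h₁' : IsCoAngularPreStep F (hullMor hF δ₁) :=
    ⟨isCoAngular_hullMor hF δ₁, isPreStep_hullMor hF δ₁ h₁.2⟩
  have h₂' : IsPreStep F (hullMor hF δ₂) := isPreStep_hullMor hF δ₂ h₂
  have hb' : BaseEquivalent F (hullMor hF δ₁) (hullMor hF δ₂) := by
    change Base F (hullMor hF δ₁) = Base F (hullMor hF δ₂)
    rw [base_hullMor, base_hullMor, show Base F δ₁ = Base F δ₂ from hb]
  refine ⟨_, ⟨hullObj hF Y, hullMor hF δ₁, hullMor hF δ₂, h₁', h₂', hb', rfl⟩, ?_⟩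
  rw [map_div, pullGp_of', pullGp_of', invDiv_hullMor hF δ₁ h₁.2.2, invDiv_hullMor hF δ₂ h₂.2,
    pull_pull_inv_eq, pull_pull_inv_eq]

/-! ### The germs and the subfunctor `Φ^birat` of `C^istr` -/

/-- The birational germs of the Frobenioid `C^istr` at an isotropic object `A` are the birational germs
of `C` at `A` (a co-angular pre-step into an isotropic object has isotropic source, Prop. 1.9 (iv), so
every pair of `C` at `A` lives in `C^istr`). [cite: MochizukiFrdI2008, Prop. 1.9 (v) p.32] -/
theorem biratGerms_istr (hF : IsFrobenioid F) (A : Istr F) :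
    biratGerms (istrFunctor F) A = biratGerms F A.obj := by
  ext d
  constructor
  · rintro ⟨Y, δ₁, δ₂, h₁, h₂, hb, rfl⟩
    exact ⟨Y.obj, δ₁.hom, δ₂.hom, (isCoAngularPreStep_istr_iff hF δ₁).mp h₁,
      (isPreStep_istr_iff δ₂).mp h₂, hb, rfl⟩
  · rintro ⟨Y, δ₁, δ₂, h₁, h₂, hb, rfl⟩
    have hY : IsIsotropic F Y :=
      (isIsotropic_iff_of_isCoAngular_isLinear hF δ₁ h₁.1 h₁.2.1).mpr A.property
    refine ⟨Istr.mk Y hY, ObjectProperty.homMk δ₁, ObjectProperty.homMk δ₂,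
      (isCoAngularPreStep_istr_iff hF _).mpr h₁, (isPreStep_istr_iff _).mpr h₂, hb, rfl⟩

/-- The generators of `Φ^birat(X)` computed in `C` and in `C^istr` generate the same subgroup: every
pulled-back germ of `C` is a pulled-back germ at an isotropic hull (`exists_biratGerm_hull`).
[cite: MochizukiFrdI2008, Prop. 4.4 (iii) p.83] -/
theorem biratSubfunctor_istr_carrier (hF : IsFrobenioid F) (X : D) :
    (biratSubfunctor (istrFunctor F)).carrier X = (biratSubfunctor F).carrier X := by
  apply le_antisymm
  · rw [biratSubfunctor_carrier, Subgroup.closure_le]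
    rintro _ ⟨A, f, d, hd, rfl⟩
    rw [biratGerms_istr hF A] at hd
    exact (biratSubfunctor F).pull_mem f (mem_biratSubfunctor_of_mem_biratGerms F hd)
  · rw [biratSubfunctor_carrier, Subgroup.closure_le]
    rintro _ ⟨A', f, d, hd, rfl⟩
    obtain ⟨d', hd', rfl⟩ := exists_biratGerm_hull hF hd
    rw [← pullGp_comp]
    have hd'' : d' ∈ biratGerms (istrFunctor F) (hullIstr hF A') := by
      rw [biratGerms_istr hF]; exact hd'
    exact (biratSubfunctor (istrFunctor F)).pull_mem _
      (mem_biratSubfunctor_of_mem_biratGerms (istrFunctor F) hd'')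

/-- **`Φ^birat(Base A)` is the set of birational germs at `A` for every ISOTROPIC object `A` of an
arbitrary Frobenioid** (abc-iut-L1-t10's `coe_biratSubfunctor_baseObj`, which assumes isotropic TYPE,
applied to the Frobenioid `C^istr` of isotropic type and transported by the two comparisons above).
[cite: MochizukiFrdI2008, Prop. 4.4 (iii) p.83] -/
theorem coe_biratSubgroup_eq_biratGerms_of_isIsotropic (hF : IsFrobenioid F) {A : C}
    (hA : IsIsotropic F A) :
    ((biratSubgroup F (baseObj F A) : Subgroup _) : Set _) = biratGerms F A := by
  have h := coe_biratSubfunctor_baseObj (istrFunctor F) (isFrobenioid_istr hF)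
    isOfIsotropicType_istr (Istr.mk A hA)
  rw [biratGerms_istr hF, biratSubfunctor_istr_carrier hF] at h
  exact h

/-- At a NON-surjective object the defect is exactly non-isotropy: if some element of `Φ^birat(Base A)`
is not a germ at `A`, then `A` is not isotropic. [cite: MochizukiFrdI2008, Prop. 4.4 (iii) p.83] -/
theorem not_isIsotropic_of_not_mem_biratGerms (hF : IsFrobenioid F) {A : C}
    {c : Algebra.GrothendieckGroup (Φ.obj (op (baseObj F A)))}
    (hc : c ∈ biratSubgroup F (baseObj F A)) (hc' : c ∉ biratGerms F A) : ¬ IsIsotropic F A :=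
  fun hA => hc' (by rw [← coe_biratSubgroup_eq_biratGerms_of_isIsotropic hF hA]; exact hc)

/-! ### Prop. 4.4 (iii) at isotropic objects of an arbitrary Frobenioid -/

variable {hF : IsFrobenioid F} (hsq : HasBiratSquares F)

/-- **[FrdI] Prop. 4.4 (iii) at an ISOTROPIC object of an ARBITRARY Frobenioid**: the divisor map
`O^×(A^birat) → Φ^birat(Base A)` onto the canonical `Φ^birat` is SURJECTIVE and its kernel is the
image of `O^×(A)` — the body of abc-iut-L1-t3's `Prop44iii` at `A` for THE birationalization
`biratData hF hsq`. (For non-isotropic `A` surjectivity can fail: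
`BirationalizationProp44iiiCounterexample.lean`; for isotropic TYPE this is
`prop44iii_biratData`.) This is the reading of (iii) through Prop. 2.2, where `O^×(−)` on `D` is
defined via `C^istr`. [cite: MochizukiFrdI2008, Prop. 4.4 (iii) p.83] -/
theorem prop44iii_at_isIsotropic {A : C} (hA : IsIsotropic F A) :
    (∀ y ∈ biratSubgroup F (baseObj F A), ∃ u, biratDivHom hF hsq A u = y) ∧
      ∀ u : (biratOps hF hsq).unitsSubgroup ((toBirat F hF hsq).obj A),
        biratDivHom hF hsq A u = 1 ↔
          ∃ α : Aut A, α ∈ unitsSubgroup F A ∧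
            (toBirat F hF hsq).mapIso α = (u : Aut ((toBirat F hF hsq).obj A)) := by
  refine ⟨fun y hy => ?_, fun u => biratDivHom_eq_one_iff hsq u⟩
  have hy' : y ∈ Set.range (biratDivHom hF hsq A) := by
    rw [range_biratDivHom hsq A, ← coe_biratSubgroup_eq_biratGerms_of_isIsotropic hF hA]
    exact hy
  exact hy'

/-- The same for the canonical composition squares. [cite: MochizukiFrdI2008, Prop. 4.4 (iii) p.83] -/
theorem prop44iii_at_isIsotropic_of_isFrobenioid (hF : IsFrobenioid F) {A : C} (hA : IsIsotropic F A) :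
    ∀ y ∈ biratSubgroup F (baseObj F A),
      ∃ u, biratDivHom hF (hasBiratSquares_of_isFrobenioid hF) A u = y :=
  (prop44iii_at_isIsotropic (hF := hF) (hasBiratSquares_of_isFrobenioid hF) hA).1

/-- Prop. 4.4 (iii) AS TYPED holds at THE birationalization as soon as every object whose base
carries a non-germ is isotropic — in particular (again) for Frobenioids of isotropic type, now derived
objectwise. [cite: MochizukiFrdI2008, Prop. 4.4 (iii) p.83] -/
theorem prop44iii_biratData_of_forall_isIsotropic (h : ∀ A : C, IsIsotropic F A) :
    PreFrobenioidData.Prop44iii (biratData hF hsq) :=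
  fun A => prop44iii_at_isIsotropic hsq (h A)

end PreFrobenioid

end Literature.AlgebraicGeometry.Frobenioids
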